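import Mathlib.NumberTheory.Padics.Complex
import Literature.NumberTheory.EllipticCurves.Newforms
import Literature.NumberTheory.EllipticCurves.Tamagawa
import Literature.NumberTheory.EllipticCurves.GlobalMinimalModel
import Literature.NumberTheory.DiophantineGeometry.Conductor
import HarnessLib

/-!
# Classical members of the Hida family through an ordinary elliptic curve (named fact, D-0014)

For an elliptic curve `E/ℚ` of conductor `N` with good *ordinary* reduction at a prime `p ≥ 5`
(`p ∤ a_p(E)`), Hida's theory of ordinary `Λ`-adic forms produces, in every weight `k > 2` with
`k ≡ 2 (mod p − 1)`, a `p`-ordinary newform `g_k ∈ S_k(Γ₀(N))` congruent to `f_E` modulo (a prime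
above) `p` — the weight-`k` member of the Hida family (branch) through the `p`-stabilisation of the
weight-`2` newform `f_E` attached to `E` by modularity.

This file vendors that existence-and-congruence statement as a named fact (a `def … : Prop`,
no `sorry`), typed on Mathlib's `CuspForm (Γ₀(N)) k` with the tree's `IsNewform0` / `coeffField`
(`Literature.NumberTheory.EllipticCurves.ModularForms`, file `Newforms.lean`) and Mathlib's
`PadicAlgCl p = \bar ℚ_p`; the congruence `g_k ≡ f_E` is expressed prime-by-prime away from `N p`
through a `p`-adic embedding `ι : K_{g_k} →+* \bar ℚ_p` of the coefficient field and the traces of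
Frobenius `a_ℓ(E)` of the (globally minimal) curve, exactly as in the route file
`Summits/BirchSwinnertonDyer/BirchSwinnertonDyer/Theses/TangentCone.lean`, whose cruxes
`EdgeDecay` (∃ a branch member in prescribed weights) and `EdgeCap` (∀ branch members) quantify
over these objects.

## Source and derivation (as printed)

* Hida, *Galois representations into `GL₂(ℤ_p[[X]])` attached to ordinary cusp forms*, Invent.
  Math. 85 (1986) and *Iwasawa modules attached to congruences of cusp forms*, Ann. Sci. ÉNS 19
  (1986): the ordinary `Λ`-adic Hecke algebra `h^ord(N; Λ)` is free of finite rank over `Λ` and is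
  *controlled*: `h^ord(N; Λ) ⊗_Λ Λ/(t − γ^k) ≅ h_k^ord(Γ₀(pN); W)` for every `k ≥ 2`
  (Hida, *Elementary Modular Iwasawa Theory* (2022), Thm. 4.1.24 "proven in [H86a] and also in
  [H86b]", Thm. 4.1.29), and for `k ≥ 3` with character defined modulo `N` the `p` may be removed
  from the level: `h^ord(N; Λ) ⊗_Λ Λ/(t − γ^k) ≅ h_k^ord(Γ₀(N); W)` sending `T(n) ↦ T(n)` for `n`
  prime to `p`, `U(p) ↦` the unit root of `X² − T(p) X + p^{k−1}` (ibid. Cor. 4.1.30, Ex. 4.1.22).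
* Emerton–Pollack–Weston, Invent. Math. 163 (2005), Thm. 2.1.2 (Hida: `T_N` free of finite rank
  over `Λ`; `T_N/℘T_N` is the Hecke algebra of `S_k(Np^∞, O(℘))^ord[κ_℘]` for a classical height-one
  prime `℘` of weight `k`), Thm. 2.2.2 (the new quotient `T_N^new` is finite and torsion-free over
  `Λ`; its classical height-one primes are exactly those whose eigenform has tame conductor `N`)
  and the closing summary of §2.1: "the classical height one primes in `T_N` correspond to Galois
  conjugacy classes of `p`-ordinary normalised Hecke eigenforms of tame level `N` and weight
  `k ≥ 2` defined over `\bar ℚ_p`".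
* Derivation of the displayed statement: by modularity (Breuil–Conrad–Diamond–Taylor 2001,
  Thm. A) `f_E = Σ a_n(E) qⁿ ∈ S_2(Γ₀(N))` is a newform of level `N = N_E`, `p ∤ N`, and it is
  `p`-ordinary because `a_p(E)` is a `p`-adic unit; its `p`-stabilisation gives a classical
  height-one prime `℘_f` of weight `2` of `T_N^new`. The irreducible component `𝕀 = T_N^new/𝔞`
  (`𝔞 ⊆ ℘_f` a minimal prime) is a local domain, finite and torsion-free over `Λ`, so above the
  weight-`k` prime `P_k` of `Λ` there lies a height-one prime `℘_k` of `𝕀` (lying over); by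
  Thm. 2.2.2 (2) its eigenform `f_{℘_k}` is a `p`-ordinary `p`-stabilised newform of tame
  conductor `N`; the finite-order (diamond/nebentypus) characters are constant along `𝕀`, so for
  `k ≡ 2 (mod p − 1)` the character of `f_{℘_k}` is trivial, and for `k > 2` an ordinary
  eigenform of level `Np` and trivial character is `p`-old, i.e. `f_{℘_k}` is the ordinary
  `p`-stabilisation of a newform `g_k ∈ S_k(Γ₀(N))`, `a_p(g_k) = α + p^{k−1}α⁻¹` with `α` the unit
  `U_p`-eigenvalue, so `|ι a_p(g_k)|_p = 1`; since `℘_f, ℘_k` lie in the same local ring `𝕀`,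
  `T_ℓ mod 𝔪_𝕀` agree: `|ι(a_ℓ(g_k)) − a_ℓ(E)|_p < 1` for all primes `ℓ ∤ N p`.

Grounds (as a hypothesis `(h : hida_exists_congruent_ordinary_newform)`) the branch-member
existence inside `Summit.BirchSwinnertonDyer.BirchSwinnertonDyer.Theses.TangentCone.EdgeDecay`
and the objects universally quantified in `…TangentCone.EdgeCap` (route TangentCone, items
stmt-BirchSwinnertonDyer-17608 / 17609). It does NOT touch the decay / cap inequalities
themselves (the two-variable `p`-adic `L`-function content), which remain open / unpublished.
-/

noncomputable section

open scoped MatrixGroups ModularForm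

namespace Literature.NumberTheory.EllipticCurves

open Literature.NumberTheory.EllipticCurves.ModularForms

/-- **Classical members of the Hida family of an ordinary elliptic curve** (Hida 1986; in the
form recalled by Emerton–Pollack–Weston 2005, Thms. 2.1.2 and 2.2.2, and Hida, *Elementary
Modular Iwasawa Theory*, Thm. 4.1.29 and Cor. 4.1.30, applied to the `p`-stabilisation of the
newform `f_E` given by modularity). Let `W` be a globally minimal Weierstrass equation of an
elliptic curve `E/ℚ` of conductor `N = W.conductorNorm ℤ`, and let `p ≥ 5` be a prime of good
ordinary reduction (`p ∤ a_p(E)`). Then for every integer `k > 2` with `k ≡ 2 (mod p − 1)` there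
exist a newform `g ∈ S_k(Γ₀(N))` (normalised new Hecke eigenform of level `N`, trivial character)
and a ring embedding `ι : K_g →+* \bar ℚ_p` of its coefficient field such that
`g` is `ι`-ordinary, `|ι(a_p(g))|_p = 1`, and `g ≡ f_E` modulo the prime of `ι`:
`|ι(a_ℓ(g)) − a_ℓ(E)|_p < 1` for every prime `ℓ ∤ N p` — `g` is the weight-`k` specialisation of
the Hida family (irreducible component of the ordinary `Λ`-adic Hecke algebra of tame level `N`)
passing through `f_E`. [cite: Hida1986] [cite: EmertonPollackWeston2005, Thm. 2.1.2, Thm. 2.2.2 and §2.1 (end)] [cite: Hida2022EMI, Thm. 4.1.24, Thm. 4.1.29, Cor. 4.1.30] -/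
def hida_exists_congruent_ordinary_newform : Prop :=
  ∀ (W : WeierstrassCurve ℚ) [W.IsElliptic] [W.IsGloballyMinimal] (_ : NeZero (W.conductorNorm ℤ))
    (p : ℕ) [Fact p.Prime], 5 ≤ p → W.HasGoodReductionAtPrime p → ¬ (p : ℤ) ∣ W.frobeniusTrace p →
    ∀ (k : ℤ), 2 < k → ((p : ℤ) - 1) ∣ (k - 2) →
    ∃ (g : CuspForm (CongruenceSubgroup.Gamma0 (W.conductorNorm ℤ)) k)
      (ι : coeffField g →+* PadicAlgCl p),
      IsNewform0 g ∧
      ‖ι ⟨(UpperHalfPlane.qExpansion 1 ⇑g).coeff p, coeff_mem_coeffField g p⟩‖ = 1 ∧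
      ∀ ℓ : ℕ, ℓ.Prime → ¬ ℓ ∣ W.conductorNorm ℤ * p →
        ‖ι ⟨(UpperHalfPlane.qExpansion 1 ⇑g).coeff ℓ, coeff_mem_coeffField g ℓ⟩
            - ((W.frobeniusTrace ℓ : ℤ) : PadicAlgCl p)‖ < 1


/-- **Classical members of the Hida family of an elliptic curve with MULTIPLICATIVE reduction at
`p` (the `p`-new weight-two base point; `p ‖ N`)** (Hida 1986, in the form recalled by
Emerton–Pollack–Weston, Invent. Math. 163 (2006), Thm. 2.1.2, Thm. 2.2.2, §2.1 and Example 5.3.1,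
and Hida, *Elementary Modular Iwasawa Theory*, Thm. 4.1.24, Thm. 4.1.29, Cor. 4.1.30). EPW Thm.
2.1.2 (Hida): "The algebra `𝕋_N` is free of finite rank over `Λ` … If `℘` is a classical height one
prime in `Λ` of weight `k`, then … `𝕋_N/℘𝕋_N` [is] the quotient of the Hecke algebra that acts
faithfully on `S_k(Np^∞, 𝒪(℘))^ord[κ_℘]`"; §2.1 (p. 7): "the classical height one primes in `𝕋_N`
correspond to Galois conjugacy classes of `p`-ordinary normalised Hecke eigenforms of tame level `N`
and weight `k ≥ 2` … `𝕋_N` acts faithfully on `S_k(Np^∞)^ord` for any (fixed) weight `k ≥ 2` …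
since `𝕋_N` is free over `Λ`, and since the intersection of all such ideals `℘` is the zero ideal";
Thm. 2.2.2: the new quotient `𝕋_N^new` is finite and torsion-free over `Λ` and its classical
height-one primes are exactly those whose eigenform has tame conductor `N`; Example 5.3.1 (p. 32):
"Set `p = 11` and let `f` denote the weight `2` newform associated to the elliptic curve `X₀(11)` …
for `k ≥ 2`, there is a unique newform `f_k` of weight `k` and level dividing `11` that is congruent
to `f` modulo `11`. For example, `f_12` is the `11`-ordinary, `11`-stabilized oldform of level `11`
attached to the Ramanujan `Δ`-function" — the base point being the weight-`2` newform of a curve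
with SPLIT MULTIPLICATIVE reduction at `p`, new at `p`. Derivation of the displayed statement, word
for word that of `hida_exists_congruent_ordinary_newform` with the base point changed: for `W`
globally minimal of conductor `N = M·p`, `p ∤ M`, `p ≥ 5` of multiplicative reduction, the newform
`f_E ∈ S_2(Γ₀(Mp))` (modularity) is a `p`-ordinary `p`-stabilised newform of tame conductor `M`
(`U_p`-eigenvalue `a_p(E) = ±1`, a unit), i.e. a classical height-one prime `℘_f` of weight `2` of
`𝕋_M^new`; the branch `𝕀 = 𝕋_M^new/𝔞` through it (`𝔞 ⊆ ℘_f` minimal; `𝕀` finite torsion-free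
over `Λ`) has a height-one prime `℘_k` over the weight-`k` prime of `Λ` for every `k ≥ 2` (lying
over), whose eigenform has tame conductor `M` (Thm. 2.2.2); nebentypus characters are constant
along `𝕀`, so for `k ≡ 2 (mod p − 1)` the character of `f_{℘_k}` is trivial, and for `k > 2` an
ordinary eigenform of level `Mp` with trivial character is `p`-OLD (a `p`-new form of weight
`k > 2` has `a_p² = p^{k−2}`, not a unit), i.e. `f_{℘_k}` is the ordinary `p`-stabilisation of a
newform `g ∈ S_k(Γ₀(M))` (`p` removed from the level for `k ≥ 3`: Hida EMI Cor. 4.1.30), with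
`|ι a_p(g)|_p = 1`; `℘_f, ℘_k ⊂ 𝕀` give `T_ℓ mod 𝔪_𝕀` equal: `|ι(a_ℓ(g)) − a_ℓ(E)|_p < 1` for all
primes `ℓ ∤ N`. STATEMENT: for `W/ℚ` globally minimal elliptic of conductor `N = W.conductorNorm ℤ`,
a prime `p ≥ 5` of multiplicative reduction, and every integer `k > 2` with `k ≡ 2 (mod p − 1)`,
there exist a newform `g ∈ S_k(Γ₀(N/p))` (normalised new eigenform of level `N/p`, trivial
character; `p ∤ N/p`) and a ring embedding `ι : K_g →+* ℚ̄_p` of its coefficient field with `g`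
`ι`-ordinary (`|ι(a_p(g))|_p = 1`) and `g ≡ f_E` modulo the prime of `ι`: `|ι(a_ℓ(g)) − a_ℓ(E)|_p < 1`
for every prime `ℓ ∤ N` — a GOOD-ordinary, higher-weight classical member of the Hida family
`H(E[p])` (EPW p. 2) through the `p`-new point `f_E`. Used by the BSD residual cell `b2b-bsdres`
(class X11a, HOME/b2b-bsdres-x11a/X11A-CHAIN.md step [L1], literature audit
HOME/b2b-bsdres-lit/g14/X11A-AUDIT.md (a)) as the partner form to which X. Wan, Forum Math. Sigma 3
(2015) Thm. 4 applies; nothing about `p`-adic `L`-functions or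
Selmer groups is asserted here. Named fact (`def … : Prop`), nothing asserted; no `_holds`.
**RETIRED-UNBOUND (cell `b2b-bsdres`, registry A77; cell-lead record 2026-08-21, x11a GEN 20):**
no consumer of record binds this fact any more. Granted the Modularity Theorem, the tree THEOREM
`exists_isNewform0_dvd_conductorNorm_div_congr_of_multiplicative_of_exists_isNewformOf`
(`HidaFamilyMembersMultiplicativeProofs.lean`: Deligne–Serre lift + `p`-stabilisation backwards)
produces an ordinary congruent member of SOME level `M′ ∣ N/p`, and that is all the `X11a` chain of
record (`Summits/BirchSwinnertonDyer/Rank1Residual/X11a/ChainAnyLevel.lean`,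
`X11a.forall_bsdp_of_namedFacts_ofLevel_heightFree`) consumes, through the level-generic member
facts over `IsOrdinaryMemberOfLevel` (`EmertonPollackWeston2006/WeightKMembers.lean` and
`Wan2015RationalMainConjecture.lean`, the `…_ofLevel` twins). The only unformalised content of the
present statement — "the level is EXACTLY `N/p`" (Hida 1986; EPW Thm. 2.2.2 (2)) — is as printed but
no longer needed. Kept verbatim (statement unchanged) only so that the legacy `X11a/Chain*`
importers binding `hHida` elaborate; do not bind it in new work; removed once no module references
it.
-- TODO(general form): every branch of 𝕋_M (any tame level M, p ∤ M, any base point, any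
-- nebentypus) has classical specialisations in every weight k ≥ 2 (EPW Thm. 2.1.2 / Hida 1986).
[cite: EmertonPollackWeston2006, Thm. 2.1.2, Thm. 2.2.2, §2.1 (arXiv:math/0404484 p. 7) and Ex. 5.3.1 (p. 32)]
[cite: Hida1986] [cite: Hida2022EMI, Thm. 4.1.24, Thm. 4.1.29, Cor. 4.1.30] -/
def hida_exists_congruent_ordinary_newform_of_multiplicative : Prop :=
  ∀ (W : WeierstrassCurve ℚ) [W.IsElliptic] [W.IsGloballyMinimal]
    (p : ℕ) [Fact p.Prime], 5 ≤ p → W.HasMultiplicativeReductionAtPrime p →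
    ∀ (_ : NeZero (W.conductorNorm ℤ / p)) (k : ℤ), 2 < k → ((p : ℤ) - 1) ∣ (k - 2) →
    ∃ (g : CuspForm (CongruenceSubgroup.Gamma0 (W.conductorNorm ℤ / p)) k)
      (ι : coeffField g →+* PadicAlgCl p),
      IsNewform0 g ∧
      ‖ι ⟨(UpperHalfPlane.qExpansion 1 ⇑g).coeff p, coeff_mem_coeffField g p⟩‖ = 1 ∧
      ∀ ℓ : ℕ, ℓ.Prime → ¬ ℓ ∣ W.conductorNorm ℤ →
        ‖ι ⟨(UpperHalfPlane.qExpansion 1 ⇑g).coeff ℓ, coeff_mem_coeffField g ℓ⟩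
            - ((W.frobeniusTrace ℓ : ℤ) : PadicAlgCl p)‖ < 1


end Literature.NumberTheory.EllipticCurves

end
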